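/-
Copyright (c) 2026 the pub-hodgecm-mathlib formalisation cell (harness21).  Prover seat hodgecm-mathlib-LH4-p06 (g5), Track A «(D-RAM) FOUR-FRAME», unit U2H, census leaf
(ρ2b′-X) `stub_U2H_fixedPointCensus_typeTwo_unit0` — T5c «TORIC LEVEL CENSUS, M∕E-RAMIFIED»: (D3-LAW) the CLOSED FORM of the top bit, side-free half — at which depth does
`κ = ρμ∕μ` die in `T_M ∕ T♮` when `M ∕ E`, `M ∕ K♮`, `K♮ ∕ F` are all ramified (LH4-p04 (g4)'s DERIVED T5s-RamM letter `2j + d_E ≤ 2jλ + 1`).  2026-09-04.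
-/
import Summits.HodgeConjecture.HodgeConjecture.Theorems.F0P3cDyRamToricLevelCensusRamMTopLawPrep   -- ★ p857792 (this seat): `N_τ` algebra and the layers `M∕E`, `M∕K_τ`, `K_τ∕F`
import HarnessLib

/-!
# T5c (D3-LAW): `κ = ρμ∕μ` dies in `T_M ∕ T♮` exactly at `M`-depth `2jλ + d_ρ + 2 − dτ − 2d_K` (type RamM)

Cell `hodgecm-mathlib` (D-0151), FLOOR 0, crux H413 = `stmt-HodgeConjecture-24833`; squad F0∕P3c∕LH4; lane `--supports stmt-HodgeConjecture-24833 --as helper` (count-neutral).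
THEOREMS ONLY (no `def`, no instance, no notation, no `sorry`, default heartbeats).  Socket served: the side-free conjunct `2j + d_E ≤ 2jλ + 1` of LH4-p04 (g4)'s T5s-RamM
`hvTop` letter (★ p857711), for the (D3) bit `χ` of ★ p857665: by ★ p857700∕p857736 `χ` (translator class) says `κ := ρμ∕μ ∈ ψ(N_Θ(U_M))·T(2c′ + d_ρ)`, in particular
`κ` lies within `exp(−(2c′ + d_ρ))` of the `Θ`-fixed `ρ`-norm-one torus `T♮`; THIS FILE computes exactly when that happens.

Frame (one field `M`): `ρ`-datum `(α, d_ρ)`, `τ := Θ∘ρ` with `τ`-datum `(α, dτ)` (`M ∕ K_τ`), the fourth field `K_τ = Fix τ` read through a `τ`-fixed `P` with `|P| = exp(−2)`,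
`|P − ρP| = exp(−2d_K)` (`F`-elements = `ρ`∧`τ`-fixed, valuations in `4ℤ`), `M` complete; `μ = λ − u`, `λΘλ = 1`, `ρu = u`, `uΘu = 1`, token `|μ − ρμ| = |ϖE^{jλ}(α − ρα)|`.
* §1 THE TOKEN ON THE FOURTH FIELD: `w := ρλ∕λ` is `τ`-fixed, `wρw = 1`, `|w − 1| = exp(−(2jλ + d_ρ))` (`|λ − ρλ| = |μ − ρμ|`); `κρκ = 1`, `|κ| = 1`.
* §2 **`exists_thetaFixed_normOne_near_iff_ramified`** — for `2c ≥ dτ`: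
  `(∃ x, Θx = x ∧ xρx = 1 ∧ |κ − x| ≤ exp(−(2c + d_ρ))) ⟺ 2c + dτ + 2d_K ≤ 2jλ + d_ρ + 2`.
  UPPER BOUND: `κ = x·t`, `t = ψ(y)` with `|y − 1| ≤ exp(−(2c+1))` (★ prep §4), `N_τ(κ) = N_τ(ψ(y)) = ψ(N_τ(y))` (★ prep §1), `|N_τ(y) − 1| ≤ exp(−(2c + dτ))` (★ prep §3),
  `ψ` gains `2d_K − 2` on the fourth field (★ prep §2) — against `|N_τ(κ) − 1| = |ρλ∕λ − 1| = exp(−(2jλ + d_ρ))` (★ `norm_tau_kappa`).  EXISTENCE: Hilbert 90 with depth on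
  `K_τ ∕ F` (★ prep §2) writes `ρλ∕λ = ρz∕z` with `|z − 1| ≤ exp(−(2c + dτ))`, ★ Serre V §3 Cor. 3 on `(τ, α, dτ)` writes `z = yτy` with `|y − 1| ≤ exp(−(2c+1))`, and
  `x := κ·(y∕ρy)` is `Θ`-fixed by `N_τ(x) = 1`.
  With LH4-p04 (g4)'s letters `dτ = 2s0`, `d_ρ + 2d_E = dτ + 2d_K` and `c = c′ = 2j − jλ` this is exactly `2j + d_E ≤ 2jλ + 1`.
HONEST LABEL.  Count-neutral (`--supports`); unconditional local algebra; the side rule (which of the two even classes `κ` selects beyond the non-norm threshold) is the sequel;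
nothing of (ρ2b′-X) is asserted — `HC_CM` is proved only modulo the 7 printed citations (2 remaining named inputs: hLiu418 = `stmt-HodgeConjecture-24832`, h413 =
`stmt-HodgeConjecture-24833`) until rung 0 closes.

## References
* [Serre1979] J.-P. Serre, *Local Fields*, GTM 67 (1979): Ch. V §3 Prop. 5 and Cor. 3 (norm groups of a totally ramified quadratic extension), Ch. IV §1 Prop. 3–4, Ch. X §1.
* [Jacobowitz1962] R. Jacobowitz, *Hermitian forms over local fields*, Amer. J. Math. 84 (1962): §4.
* [Kottwitz1986BaseChangeUnits] R. E. Kottwitz, *Base change for unit elements of Hecke algebras*, Compositio Math. 60 (1986): §1 pp. 240–241.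
-/

set_option autoImplicit false

noncomputable section

namespace Summit.HodgeConjecture.HodgeConjecture.Cruxes.H413.F0P3cDyRamToricLevelCensusRamM

open WithZero IsLocalRing
open scoped Valued
open Literature.NumberTheory.Automorphic.UnitaryThreeFourFrame (IsRamifiedQuadraticDatum)
open Literature.NumberTheory.LocalFields.QuadraticOrder Literature.NumberTheory.LocalFields.WildQuadraticDatum

variable {K : Type} [Field K] [Valued K ℤᵐ⁰] {ρ Θ τ : K →+* K} {α ϖE : K} {dρ t dτ tτ : ℕ}

/-! ## §1 The tokens: `w = ρλ∕λ` on the fourth field, `κ = ρμ∕μ` on the torus -/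

/-- **THE FOURTH-FIELD TOKEN `w = ρλ∕λ`**: for `λΘλ = 1`, `ρu = u`, `τ = Θρ`, and the census token `|(λ − u) − ρ(λ − u)| = |ϖE^{jλ}(α − ρα)|`: `τw = w`, `wρw = 1`, and
`|w − 1| = exp(−(2jλ + d_ρ))` (`λ − ρλ = μ − ρμ`, `|λ| = 1`). [cite: Jacobowitz1962, §4] [cite: Serre1979, Ch. V §3] -/
theorem token_twist_lam (hD : IsRamifiedQuadraticDatum ρ α dρ t) (hτ : ∀ x, τ x = Θ (ρ x)) (hΘρ : ∀ x, Θ (ρ x) = ρ (Θ x))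
    (hvΘ : ∀ x, Valued.v (Θ x) = Valued.v x) (hϖE : Valued.v ϖE = exp (-2 : ℤ))
    {lam u : K} (hlam : lam * Θ lam = 1) (hu : ρ u = u) {jl : ℕ} (hjl : Valued.v ((lam - u) - ρ (lam - u)) = Valued.v (ϖE ^ jl * (α - ρ α))) :
    τ (ρ lam / lam) = ρ lam / lam ∧ ρ lam / lam * ρ (ρ lam / lam) = 1 ∧ Valued.v (ρ lam / lam - 1) = exp (-(2 * (jl : ℤ) + dρ)) := by
  obtain ⟨hρρ, hvρ, -, -, -, -, -⟩ := id hD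
  have hlam0 : lam ≠ 0 := fun h0 => by rw [h0, zero_mul] at hlam; exact zero_ne_one hlam
  have hρlam0 : ρ lam ≠ 0 := (map_ne_zero ρ).2 hlam0
  have hvlam : Valued.v lam = 1 := v_eq_one_of_v_mul_map_eq_one hvΘ (by rw [hlam]; exact Valuation.map_one _)
  have hΘlam : Θ lam = lam⁻¹ := (inv_eq_of_mul_eq_one_right hlam).symm
  have hΘρlam : Θ (ρ lam) = (ρ lam)⁻¹ := by
    have h1 : ρ lam * Θ (ρ lam) = 1 := by rw [hΘρ, ← map_mul, hlam, map_one]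
    exact (inv_eq_of_mul_eq_one_right h1).symm
  refine ⟨?_, ?_, ?_⟩
  · rw [map_div₀, hτ, hτ, hρρ, hΘlam, hΘρlam, inv_div_inv]
  · rw [map_div₀, hρρ]; field_simp
  · have hsub : lam - ρ lam = (lam - u) - ρ (lam - u) := by rw [map_sub, hu]; ring
    rw [div_sub_one hlam0, map_div₀, hvlam, div_one, ← neg_sub, Valuation.map_neg, hsub, hjl, v_conductorR (v_sub_map_eq_exp_of_datum hD) hϖE]

/-- **THE TORUS TOKEN `κ = ρμ∕μ`**: `κρκ = 1` and `|κ| = 1` (`μ ≠ 0`). [cite: Serre1979, Ch. V §3] -/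
theorem token_twist_mu (hρρ : ∀ x, ρ (ρ x) = x) (hvρ : ∀ x, Valued.v (ρ x) = Valued.v x) {μ : K} (hμ0 : μ ≠ 0) :
    ρ μ / μ * ρ (ρ μ / μ) = 1 ∧ Valued.v (ρ μ / μ) = 1 := by
  have hρμ0 : ρ μ ≠ 0 := (map_ne_zero ρ).2 hμ0
  refine ⟨by rw [map_div₀, hρρ]; field_simp, by rw [map_div₀, hvρ, div_self ((Valuation.ne_zero_iff _).2 hμ0)]⟩

/-! ## §2 (LAW-i) `κ` is within `exp(−(2c + d_ρ))` of `T♮` iff `2c + dτ + 2d_K ≤ 2jλ + d_ρ + 2` -/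

/-- **(D3-LAW, SIDE-FREE HALF) — WHERE `κ` DIES IN `T_M ∕ T♮`, TYPE RamM.**  In the frame above (`M` complete; `ρ`-datum `(α, d_ρ)`; `τ = Θρ` with `τ`-datum `(α, dτ)`; the
fourth field through `P`, `d_K`, and the `4ℤ`-parity of `F`), for `μ = λ − u` (`λΘλ = 1`, `ρu = u`, `uΘu = 1`) with token `|μ − ρμ| = |ϖE^{jλ}(α − ρα)|` and a radius exponent
`c` with `dτ ≤ 2c`:  **`(∃ x, Θx = x ∧ xρx = 1 ∧ |ρμ∕μ − x| ≤ exp(−(2c + d_ρ))) ⟺ 2c + dτ + 2d_K ≤ 2jλ + d_ρ + 2`.**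
With `dτ = 2s0`, `d_ρ + 2d_E = dτ + 2d_K` and `c = 2j − jλ` on the diagonal this is LH4-p04 (g4)'s DERIVED bit `2j + d_E ≤ 2jλ + 1` — the RamM twin of LH4-p08 (g5)'s
★ `topBit_hyper_iff` depth conjunct `2j + d ≤ 2jλ + 1`. [cite: Serre1979, Ch. V §3 Prop. 5, Cor. 3] [cite: Jacobowitz1962, §4] [cite: Kottwitz1986BaseChangeUnits, §1 pp. 240–241] -/
theorem exists_thetaFixed_normOne_near_iff_ramified [CompleteSpace K]
    (hD : IsRamifiedQuadraticDatum ρ α dρ t) (hΘΘ : ∀ x, Θ (Θ x) = x) (hΘρ : ∀ x, Θ (ρ x) = ρ (Θ x)) (hvΘ : ∀ x, Valued.v (Θ x) = Valued.v x)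
    (hτ : ∀ x, τ x = Θ (ρ x)) (hDτ : IsRamifiedQuadraticDatum τ α dτ tτ)
    {P : K} (hτP : τ P = P) (hP : Valued.v P = exp (-2 : ℤ)) {dK : ℕ} (hdK : Valued.v (P - ρ P) = exp (-(2 * (dK : ℤ))))
    (hF4 : ∀ f : K, ρ f = f → τ f = f → f ≠ 0 → ∃ n : ℤ, Valued.v f = exp (4 * n))
    (hϖE : Valued.v ϖE = exp (-2 : ℤ)) {lam u : K} (hlam : lam * Θ lam = 1) (hu : ρ u = u) (hu1 : u * Θ u = 1)
    {jl : ℕ} (hjl : Valued.v ((lam - u) - ρ (lam - u)) = Valued.v (ϖE ^ jl * (α - ρ α))) {c : ℕ} (hc : dτ ≤ 2 * c) :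
    (∃ x : K, Θ x = x ∧ x * ρ x = 1 ∧ Valued.v (ρ (lam - u) / (lam - u) - x) ≤ exp (-(2 * (c : ℤ) + dρ))) ↔
      2 * (c : ℤ) + dτ + 2 * dK ≤ 2 * jl + dρ + 2 := by
  obtain ⟨hρρ, hvρ, hα, -, -, -, -⟩ := id hD
  obtain ⟨hττ, hvτ, -, hfixτ, -, hdτ1, -⟩ := id hDτ
  haveI : IsAdicComplete 𝓂[K] 𝒪[K] := Literature.NumberTheory.LocalFields.isAdicComplete_valuedInteger_of_completeSpace hα
  obtain ⟨hτw, hw, hvw⟩ := token_twist_lam hD hτ hΘρ hvΘ hϖE hlam hu hjl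
  -- `μ ≠ 0` (else the token `|μ − ρμ|` would vanish)
  have hμ0 : lam - u ≠ 0 := by
    intro h0
    rw [h0, map_zero, sub_zero, map_zero] at hjl
    rw [v_conductorR (v_sub_map_eq_exp_of_datum hD) hϖE] at hjl
    exact exp_ne_zero hjl.symm
  have hρμ0 : ρ lam - u ≠ 0 := by
    intro h0
    have : ρ (lam - u) = 0 := by rw [map_sub, hu]; exact h0
    exact (map_ne_zero ρ).2 hμ0 this
  obtain ⟨hκ, hκ1⟩ := token_twist_mu hρρ hvρ hμ0
  set κ : K := ρ (lam - u) / (lam - u) with hκdef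
  have hκ0 : κ ≠ 0 := fun h0 => by rw [h0, map_zero] at hκ1; exact zero_ne_one hκ1
  have hNκ : κ * τ κ = ρ lam / lam := norm_tau_kappa hτ hρρ hΘρ hlam hu hu1 hμ0 hρμ0
  constructor
  · -- UPPER BOUND
    rintro ⟨x, hΘx, hx, hκx⟩
    have hvx : Valued.v x = 1 := v_eq_one_of_v_mul_map_eq_one hvρ (by rw [hx]; exact Valuation.map_one _)
    have hx0 : x ≠ 0 := fun h0 => by rw [h0, map_zero] at hvx; exact zero_ne_one hvx
    -- `t := κ·ρx` is norm-one with `|t − 1| = |κ − x|`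
    have ht : κ * ρ x * ρ (κ * ρ x) = 1 := by
      rw [map_mul, hρρ]; linear_combination (x * ρ x) * hκ + hx
    have htd : Valued.v (κ * ρ x - 1) ≤ exp (-(2 * (c : ℤ) + dρ)) := by
      have h1 : κ * ρ x - 1 = (κ - x) * ρ x := by linear_combination hx
      rw [h1, map_mul, hvρ, hvx, mul_one]; exact hκx
    obtain ⟨y, hy, hty⟩ := exists_oneUnit_twist_eq hD ht htd
    -- `N_τ(κ) = N_τ(x)·N_τ(t) = ψ(N_τ(y))`
    have hy0 : y ≠ 0 := by
      rintro rfl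
      rw [zero_sub, Valuation.map_neg, Valuation.map_one, ← exp_zero, exp_le_exp] at hy; omega
    have hNx : x * τ x = 1 := mul_tau_eq_one_of_thetaFixed hτ hΘx hx
    have hchain : ρ lam / lam = ρ (y * τ y) / (y * τ y) := by
      rw [← hNκ, ← norm_tau_twist hτ hρρ hΘρ y, hty]
      have : κ = x * (κ * ρ x) := by
        rw [← mul_assoc, mul_comm x, mul_assoc, hx, mul_one]
      conv_lhs => rw [this]
      rw [map_mul τ, mul_mul_mul_comm, hNx, one_mul]
    -- depth of `z := N_τ(y)`: `|z − 1| ≤ exp(−(2c + dτ))`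
    have hz : Valued.v (y * τ y - 1) ≤ exp (-(2 * (c : ℤ) + dτ)) := by
      have h := v_mul_tau_sub_one_le hDτ (i := 2 * c + 1) (by push_cast; exact hy) (by omega)
      refine h.trans_eq ?_; congr 1; push_cast; ring
    have hτz' : τ (y * τ y - 1) = y * τ y - 1 := by rw [map_sub, map_one, map_mul, hττ, mul_comm]
    -- `ψ` gains `2d_K − 2` on the fourth field
    have hψz := v_sub_map_le_of_tauFixed hτ hρρ hΘρ hF4 hτP hP hdK hτz'
    have hz1 : Valued.v (y * τ y) = 1 := by
      have hlt : Valued.v (y * τ y - 1) < 1 := hz.trans_lt (by rw [← exp_zero, exp_lt_exp]; omega)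
      have : y * τ y = 1 + (y * τ y - 1) := by ring
      rw [this, Valuation.map_add_eq_of_lt_left _ (by rw [Valuation.map_one]; exact hlt), Valuation.map_one]
    have hz0 : y * τ y ≠ 0 := fun h0 => by rw [h0, map_zero] at hz1; exact zero_ne_one hz1
    have hfinal : Valued.v (ρ lam / lam - 1) ≤ exp (-(2 * (c : ℤ) + dτ)) * exp (-(2 * (dK : ℤ) - 2)) := by
      rw [hchain, div_sub_one hz0, map_div₀, hz1, div_one]
      have h1 : ρ (y * τ y) - y * τ y = -((y * τ y - 1) - ρ (y * τ y - 1)) := by rw [map_sub, map_one]; ring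
      rw [h1, Valuation.map_neg]
      exact hψz.trans (mul_le_mul_left hz _)
    rw [hvw, ← exp_add, exp_le_exp] at hfinal
    omega
  · -- EXISTENCE
    intro hle
    -- Hilbert 90 with depth on `K_τ ∕ F`: `ρλ∕λ = ρz∕z`, `|z − 1| ≤ exp(−(2jλ + d_ρ − 2d_K + 2)) ≤ exp(−(2c + dτ))`
    obtain ⟨z, hτz, hz1, hzw, hzd⟩ := exists_tauFixed_twist_eq_of_depth hτ hρρ hΘρ hvρ hfixτ hF4 hτP hP hdK hτw hw hvw.le (by omega)
    have hzd' : Valued.v (z - 1) ≤ Valued.v α ^ (2 * dτ) := by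
      refine hzd.trans ?_
      rw [hα, ← exp_nsmul, nsmul_eq_mul, exp_le_exp]; push_cast; omega
    -- Serre V §3 Cor. 3 on `(τ, α, dτ)`: `z = yτy`, `|y − 1| ≤ exp(−(2c + 1))`
    obtain ⟨y, hyz, hyd⟩ := exists_mul_map_eq_of_isRamifiedQuadraticDatum τ α dτ tτ hDτ z hτz hzd'
    have hα0 : 0 < Valued.v α ^ dτ := by rw [hα]; exact pow_pos (zero_lt_iff.2 exp_ne_zero) _
    have hzle : Valued.v (z - 1) ≤ exp (-(2 * (c : ℤ) + dτ)) := hzd.trans (by rw [exp_le_exp]; omega)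
    have hαd : Valued.v α ^ dτ = exp (-(dτ : ℤ)) := by rw [hα, ← exp_nsmul, nsmul_eq_mul]; congr 1; ring
    have hy : Valued.v (y - 1) ≤ exp (-(2 * (c : ℤ) + 1)) := by
      have h2 : Valued.v (y - 1) * Valued.v α ^ dτ ≤ exp (-(2 * (c : ℤ) + 1)) * Valued.v α ^ dτ := by
        refine hyd.trans ?_
        rw [hαd, hα, ← exp_add]
        calc Valued.v (z - 1) * exp (-1 : ℤ) ≤ exp (-(2 * (c : ℤ) + dτ)) * exp (-1 : ℤ) := mul_le_mul_left hzle _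
          _ = exp (-(2 * (c : ℤ) + 1) + -(dτ : ℤ)) := by rw [← exp_add]; congr 1; ring
      exact le_of_mul_le_mul_right h2 hα0
    -- the twist `t := ρy∕y` and the `Θ`-fixed element `x := κ·(y∕ρy)`
    have hy0 : y ≠ 0 := by
      rintro rfl
      rw [zero_sub, Valuation.map_neg, Valuation.map_one, ← exp_zero, exp_le_exp] at hy; omega
    have hρy0 : ρ y ≠ 0 := (map_ne_zero ρ).2 hy0
    have htd := v_twist_sub_one_le_of_oneUnit hD hy
    have hX : κ * (y / ρ y) * ρ (κ * (y / ρ y)) = 1 := by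
      rw [map_mul, mul_mul_mul_comm, hκ, one_mul, map_div₀, hρρ, div_mul_div_comm, mul_comm y]
      exact div_self (mul_ne_zero hρy0 hy0)
    refine ⟨κ * (y / ρ y), ?_, hX, ?_⟩
    · -- `N_τ(x) = N_τ(κ) ∕ N_τ(ψ(y)) = w ∕ w = 1`
      refine thetaFixed_of_mul_tau_eq_one hτ hρρ hΘΘ hΘρ hX ?_
      have hNt : ρ y / y * τ (ρ y / y) = ρ lam / lam := by rw [norm_tau_twist hτ hρρ hΘρ, hyz, hzw]
      have hyy : y / ρ y = (ρ y / y)⁻¹ := by rw [inv_div]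
      have hw0 : ρ lam / lam ≠ 0 := fun h0 => by rw [h0, zero_mul] at hw; exact zero_ne_one hw
      rw [map_mul, mul_mul_mul_comm, hNκ, hyy, map_inv₀, ← mul_inv, hNt, mul_inv_cancel₀ hw0]
    · have h1 : κ - κ * (y / ρ y) = κ * (y / ρ y) * (ρ y / y - 1) := by field_simp
      rw [h1, map_mul, map_mul, hκ1, one_mul, map_div₀, hvρ, div_self ((Valuation.ne_zero_iff _).2 hy0), one_mul]
      exact htd

end Summit.HodgeConjecture.HodgeConjecture.Cruxes.H413.F0P3cDyRamToricLevelCensusRamM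

end
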